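import Literature.IUT.HodgeTheaters.BadLocalFrobenioidBases
import Literature.IUT.HodgeTheaters.GaloisCosetFields
import Literature.IUT.HodgeTheaters.SplitFrobenioids
import Literature.AlgebraicGeometry.Frobenioids.PadicFrobenioidBadLocalKit
import Literature.AlgebraicGeometry.Frobenioids.PadicFrobenioidBaseTransport
import Literature.AlgebraicGeometry.Frobenioids.ModelFrobenioidBaseChangeEquivalence
import HarnessLib

/-!
# [IUTchI] Example 3.2 (iv), (v): `C⊢_v`, `τ⊢_v` over the REAL base `𝓑(K_v)⁰`, `C^Θ_v`, `τ^Θ_v` over `D^Θ_v`, and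
# the equivalence `C⊢_v ⥲ C^Θ_v` over `D⊢_v ⥲ D^Θ_v` (MERGE L5 × L1, small coset models)

Mochizuki, *Inter-universal Teichmüller Theory I*, kurims manuscript (May 2020), Example 3.2 (iv) p. 71 and (v)
pp. 72–73 [cite: Mochizuki2012, I Ex 3.2 (iv)(v) pp.71-73] (D-0012 claim key, status disputed; nothing of the series
is asserted — this file CONSTRUCTS objects over the small models of `BadLocalFrobenioidBases.lean`).

Print (iv) p. 71: "the image of `q̲_v` determines a constant section [i.e., a sub-monoid on `D_v` isomorphic to `ℕ`]
`log_Φ(q̲_v)` of `Φ_{C_v}`. Moreover, the resulting submonoid `Φ_{C⊢_v} := ℕ·log_Φ(q̲_v)|_{D⊢_v}` … determines a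
`p_v`-adic Frobenioid with base category given by `D⊢_v` [cf. [FrdII], Example 1.1, (ii)] `C⊢_v` … `q̲_v` determines a
`μ_{2l}(−)`-orbit of characteristic splittings `τ⊢_v` on `C⊢_v`"; (v) p. 72: "the monoid `𝒪^▷_{C^Θ_v}(−)` determines
… a `p_v`-adic Frobenioid with base category given by `D^Θ_v` [cf. [FrdII], Example 1.1, (ii)] `C^Θ_v` … equipped
with a `μ_{2l}(−)`-orbit of characteristic splittings `τ^Θ_v` … we have a natural equivalence of categories
`C⊢_v ⥲ C^Θ_v` that maps `τ⊢_v` to `τ^Θ_v`", relative to `D⊢_v ⥲ D^Θ_v` and "compatible with the assignment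
`q̲_v|_{T_A} ↦ Θ̲_v|_{T_{A^Θ}}`".

WHAT IS CONSTRUCTED (everything REAL except the generator's NAME on the `Θ` side, see MODELLING CHOICE):
* `GaloisValDatum.relEmb` — the `K_v`-RELATIVE structure `K_v ↪ Ω^U` (valuative, compatible with `x ↦ g·x`) on
  the field functor `Spec L ↦ L` of `𝓑(K_v)⁰ = CosetCat Gal(Ω/K_v)` (`GaloisCosetFields.lean`), i.e. the input
  `PadicFrd.RelEmb` of abc-iut-L1-t4's bad-place export `PadicFrobenioidBadLocalKit.lean`
  [cite: MochizukiFrdII2008, Ex 1.1 (ii) p.8]; `RelEmb.restrict` — its restriction along a functor of bases.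
* `GaloisValDatum.Cdash q̲ / CdashBase / tauDashOf` — `C⊢_v` := the MONOGENIC `p_v`-adic Frobenioid over `𝓑(K_v)⁰`
  generated by the constant section "image of `q̲_v`" (`q̲_v ∈ 𝒪^▷_{K_v}` a non-unit), `τ⊢_v` := the characteristic
  splittings of ALL associates `q″` of `q̲_v` (the `μ_{2l}`-orbit are associates; for a non-associate `q″` the
  value is the JUNK value `τ(q̲_v)`, documented — the interface field `tauDashOf` is a total function).
* `BadLocalGroupDatum.thetaBase T d := prodEquiv⁻¹ ⋙ (Spec L ↦ L)` — the base-field functor "`A^Θ ↦ Spec L`" of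
  `D^Θ_v` (`A^Θ = Ÿ_v × Spec L` has base field `L`, `Ÿ_v` having base field `K_v`); `CTheta / CThetaBase /
  tauThetaOf` — `C^Θ_v` := the monogenic `p_v`-adic Frobenioid OVER `D^Θ_v` generated by the same constant section
  read through `prodEquiv⁻¹`, `τ^Θ_v` likewise.
* `dashThetaHom` — the morphism of [FrdII] model data OVER the equivalence `prodEquiv : D⊢_v ⥲ D^Θ_v` given by the
  pull-back maps along its unit (abc-iut-L1-t4's `ModelFrobenioid.restrictAlong`); `dashThetaEquiv : C⊢_v ≌ C^Θ_v`
  — an EQUIVALENCE by abc-iut-w5-d137's `DataHomOver.functor_isEquivalence` ([FrdI] Cor. 5.4 "the horizontal arrows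
  are equivalences"); `dashThetaEquiv_base` — it lies over `prodEquiv` ON THE NOSE; `dashThetaEquiv_tau` — it maps
  `τ(q″)` on `C⊢_v` to `τ(q″)` on `C^Θ_v` for every `q″` (so `τ⊢_v ↦ τ^Θ_v` member by member).
MODELLING CHOICE (disclosed, as in `GoodLocalFrobenioidOfKit.lean`): print's `𝒪^▷_{C^Θ_v}(A^Θ) = 𝒪^×(T_{A^Θ})·Θ̲_v^ℕ`
lives in the birationalized tempered Frobenioid `F÷_v` of [EtTh] §5 (not in the tree); here the generator of
`Φ_{C^Θ_v} ≅ ℕ` is the divisor class of `q̲_v` READ AS the formal symbol `log(Θ̲_v)` — print's "compatible with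
`q̲_v|_{T_A} ↦ Θ̲_v|_{T_{A^Θ}}`" is then the statement that `dashThetaEquiv` maps generator to generator
(`dashThetaEquiv_tau`). The embedding `C^Θ_v ⊆ F÷_v` is part of the tempered-side INPUT of the assembly file.
-/

noncomputable section

namespace Literature.AlgebraicGeometry.Frobenioids.PadicFrd.RelEmb

open CategoryTheory

universe v v' u u'

variable {D : Type u} [Category.{v} D] {D' : Type u} [Category.{v'} D'] {p : ℕ} {base : D ⥤ PadicFld.{u} p}
  {Kv : Type u} [Field Kv] [ValuativeRel Kv]

/-- Restriction of a `K_v`-relative structure along a functor of bases `F : D' → D` (the embeddings at `F A`).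
[cite: MochizukiFrdII2008, Ex 1.1 (ii) p.8] -/
def restrict (E : RelEmb base Kv) (F : D' ⥤ D) : RelEmb (F ⋙ base) Kv where
  emb A := E.emb (F.obj A)
  isValHom A := E.isValHom (F.obj A)
  comp f := E.comp (F.map f)

/-- The images of `q′` for the restricted structure are those at `F A`. [cite: MochizukiFrdII2008, Ex 1.1 (ii) p.8] -/
@[simp] theorem restrict_img (E : RelEmb base Kv) (F : D' ⥤ D) (q' : intNonzero Kv) (A : D') :
    (E.restrict F).img q' A = E.img q' (F.obj A) := rfl

end Literature.AlgebraicGeometry.Frobenioids.PadicFrd.RelEmb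

namespace Literature.IUT.HodgeTheaters

open CategoryTheory Opposite Literature.AnabelianGeometry.SemiGraphs Literature.AlgebraicGeometry.Frobenioids
open Literature.AlgebraicGeometry.Frobenioids.PadicFrd

universe u

namespace GaloisValDatum

variable {p : ℕ} [Fact p.Prime] (d : GaloisValDatum.{u} p)

/-! ### The `K_v`-relative structure on `Spec L ↦ L` -/

/-- **`K_v ↪ Ω^U` for every open `U ⊆ Gal(Ω/K_v)`**: the `K_v`-relative structure on the field functor of
`𝓑(K_v)⁰` (valuative since the valuation of `Ω` extends that of `K_v`; compatible with `x ↦ g·x` since `g` fixes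
`K_v`). [cite: MochizukiFrdII2008, Ex 1.1 (ii) p.8] -/
def relEmb : RelEmb d.fieldFunctor d.k where
  emb X := (algebraMap d.k (d.fixedFld X) : d.k →+* d.fixedFld X)
  isValHom X := fun a b => by
    change @ValuativeRel.vle (d.fixedFld X) _ (d.valOn (d.fixedFld X)) (algebraMap d.k (d.fixedFld X) a)
      (algebraMap d.k (d.fixedFld X) b) ↔ a ≤ᵥ b
    rw [d.valOn_iff]
    exact ValuativeExtension.vle_iff_vle a b
  comp {X Y} f := by
    refine RingHom.ext fun a => Subtype.ext ?_
    obtain ⟨g, hg⟩ := Quotient.exists_rep (CosetCat.pt f)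
    change ((d.fixedHom f (algebraMap d.k (d.fixedFld Y) a) : d.fixedFld X) : d.Ω) = algebraMap d.k d.Ω a
    rw [d.fixedHom_apply_coe f g hg.symm]
    exact g.commutes a

/-- The embedding at `U` is the structure map `K_v → Ω^U`. [cite: MochizukiFrdII2008, Ex 1.1 (ii) p.8] -/
theorem relEmb_emb (X : CosetCat d.Gal) : d.relEmb.emb X = algebraMap d.k (d.fixedFld X) := rfl

/-! ### (iv) `C⊢_v`, `τ⊢_v` over `D⊢_v = 𝓑(K_v)⁰` -/

variable {q : intNonzero d.k} (hq : ¬ IsUnit q)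

/-- **`C⊢_v`** over the REAL base `𝓑(K_v)⁰`: the monogenic `p_v`-adic Frobenioid of `Φ_{C⊢_v} := ℕ·log_Φ(q̲_v)`
(abc-iut-L1-t4's `BadLocalKit.Cdash` over `relEmb`), for a non-unit `q̲_v ∈ 𝒪^▷_{K_v}`.
[cite: Mochizuki2012, I Ex 3.2 (iv) p.71] -/
abbrev Cdash : Type u :=
  BadLocalKit.Cdash d.relEmb d.fieldFunctor_isPadicLocal CosetCat.isConnected CosetCat.isTotallyEpimorphic hq

/-- Its [FrdII] datum. [cite: Mochizuki2012, I Ex 3.2 (iv) p.71] -/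
abbrev dashDatum : Datum (CosetCat d.Gal) p :=
  BadLocalKit.datum d.relEmb d.fieldFunctor_isPadicLocal CosetCat.isConnected CosetCat.isTotallyEpimorphic hq

/-- `C⊢_v → D⊢_v` ("with base category given by `D⊢_v`"). [cite: Mochizuki2012, I Ex 3.2 (iv) p.71] -/
abbrev CdashBase : d.Cdash hq ⥤ CosetCat d.Gal :=
  BadLocalKit.CdashBase d.relEmb d.fieldFunctor_isPadicLocal CosetCat.isConnected CosetCat.isTotallyEpimorphic hq

open Classical in
/-- **`τ⊢_v` member by member**: the characteristic splitting on `C⊢_v` determined by a `q″ ∈ 𝒪^▷_{K_v}` — for an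
associate `q″` of `q̲_v` (e.g. `ζ·q̲_v`, `ζ ∈ μ_{2l}`) abc-iut-L1-t4's `BadLocalKit.tauDashOf q″`; for a NON-associate
the JUNK value `τ(q̲_v)` (the interface field is a total function; only associates are ever used).
[cite: Mochizuki2012, I Ex 3.2 (iv) p.71] -/
def tauDashOf (q'' : intNonzero d.k) : S3Local.CharSplitting (d.Cdash hq) :=
  if h : Associated q'' q then
    ⟨(BadLocalKit.tauDashOf d.relEmb d.fieldFunctor_isPadicLocal CosetCat.isConnected CosetCat.isTotallyEpimorphic
      hq q'' h).τ⟩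
  else ⟨(BadLocalKit.tauDash d.relEmb d.fieldFunctor_isPadicLocal CosetCat.isConnected CosetCat.isTotallyEpimorphic
    hq).τ⟩

/-- For an associate `q″ ~ q̲_v`, `tauDashOf q″` is the splitting "rational function a power of `q″`".
[cite: Mochizuki2012, I Ex 3.2 (iv) p.71] -/
theorem tauDashOf_sect (q'' : intNonzero d.k) (h : Associated q'' q) (A : d.Cdash hq) :
    (d.tauDashOf hq q'').sect A =
      (d.dashDatum hq).cSplittingSubmonoid (fun X => intNonzeroToUnits (d.fieldFunctor.obj X).K (d.relEmb.img q'' X)) A := by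
  rw [tauDashOf, dif_pos h]
  rfl

end GaloisValDatum

/-! ### (v) `C^Θ_v`, `τ^Θ_v` over `D^Θ_v` and `C⊢_v ⥲ C^Θ_v` -/

namespace BadLocalGroupDatum

variable {p : ℕ} [Fact p.Prime] (d : GaloisValDatum.{u} p) {P : Type u} [Group P] [TopologicalSpace P]
  (T : BadLocalGroupDatum d.Gal P)

/-- **The base-field functor of `D^Θ_v`, "`A^Θ ↦ Spec(L)`"** (`A^Θ = Ÿ_v × Spec L` has base field `L`, the base
field of `Ÿ_v` being `K_v`): `prodEquiv⁻¹` followed by `Spec L ↦ L`. [cite: Mochizuki2012, I Ex 3.2 (v) p.72] -/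
abbrev thetaBase : T.DTheta ⥤ PadicFld.{u} p := T.prodEquiv.inverse ⋙ d.fieldFunctor

/-- Its objects are `p_v`-adic local fields. [cite: Mochizuki2012, I Ex 3.2 (v) p.72] -/
theorem thetaBase_isPadicLocal (A : T.DTheta) : ((T.thetaBase d).obj A).IsPadicLocal :=
  d.fieldFunctor_isPadicLocal _

/-- `D^Θ_v` is connected (equivalent to `D⊢_v`). [cite: Mochizuki2012, I Ex 3.2 (v) p.72] -/
theorem isConnected_DTheta : IsConnected T.DTheta :=
  haveI : IsConnected (CosetCat d.Gal) := CosetCat.isConnected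
  isConnected_of_equivalent T.prodEquiv

/-- `D^Θ_v` is totally epimorphic (a faithful functor to the totally epimorphic `D⊢_v` reflects cancellation).
[cite: Mochizuki2012, I Ex 3.2 (v) p.72] -/
theorem isTotallyEpimorphic_DTheta : IsTotallyEpimorphic T.DTheta :=
  ⟨fun f => ⟨fun g h hgh => T.prodEquiv.inverse.map_injective
    ((CosetCat.isTotallyEpimorphic.epi (T.prodEquiv.inverse.map f)).left_cancellation _ _
      (by simpa only [Functor.map_comp] using congrArg T.prodEquiv.inverse.map hgh))⟩⟩

variable {q : intNonzero d.k} (hq : ¬ IsUnit q)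

/-- The [FrdII] datum of `C^Θ_v` over `D^Θ_v`: monogenic, generated by the constant section "image of `q̲_v`" READ
AS `log(Θ̲_v)` (module docstring, MODELLING CHOICE). [cite: Mochizuki2012, I Ex 3.2 (v) p.72] -/
abbrev thetaDatum : Datum T.DTheta p :=
  BadLocalKit.datum (d.relEmb.restrict T.prodEquiv.inverse) (T.thetaBase_isPadicLocal d) (T.isConnected_DTheta d)
    (T.isTotallyEpimorphic_DTheta d) hq

/-- **`C^Θ_v`**: "a `p_v`-adic Frobenioid with base category given by `D^Θ_v` [cf. [FrdII], Example 1.1, (ii)]".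
[cite: Mochizuki2012, I Ex 3.2 (v) p.72] -/
abbrev CTheta : Type u := (T.thetaDatum d hq).frobenioid

/-- `C^Θ_v → D^Θ_v`. [cite: Mochizuki2012, I Ex 3.2 (v) p.72] -/
abbrev CThetaBase : T.CTheta d hq ⥤ T.DTheta := ModelFrobenioid.baseFunctor _ _ (T.thetaDatum d hq).divB

open Classical in
/-- **`τ^Θ_v` member by member**: the characteristic splitting on `C^Θ_v` determined by (the symbol `log Θ̲″` read
off) an associate `q″` of `q̲_v`; junk value `τ(q̲_v)` at non-associates, as for `tauDashOf`.
[cite: Mochizuki2012, I Ex 3.2 (v) p.72] -/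
def tauThetaOf (q'' : intNonzero d.k) : S3Local.CharSplitting (T.CTheta d hq) :=
  if h : Associated q'' q then
    ⟨(BadLocalKit.tauDashOf (d.relEmb.restrict T.prodEquiv.inverse) (T.thetaBase_isPadicLocal d)
      (T.isConnected_DTheta d) (T.isTotallyEpimorphic_DTheta d) hq q'' h).τ⟩
  else ⟨(BadLocalKit.tauDash (d.relEmb.restrict T.prodEquiv.inverse) (T.thetaBase_isPadicLocal d)
    (T.isConnected_DTheta d) (T.isTotallyEpimorphic_DTheta d) hq).τ⟩

/-- For an associate `q″ ~ q̲_v`, `tauThetaOf q″` is the splitting "rational function a power of `q″`".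
[cite: Mochizuki2012, I Ex 3.2 (v) p.72] -/
theorem tauThetaOf_sect (q'' : intNonzero d.k) (h : Associated q'' q) (A : T.CTheta d hq) :
    (T.tauThetaOf d hq q'').sect A =
      (T.thetaDatum d hq).cSplittingSubmonoid
        (fun X => intNonzeroToUnits ((T.thetaBase d).obj X).K ((d.relEmb.restrict T.prodEquiv.inverse).img q'' X)) A := by
  rw [tauThetaOf, dif_pos h]
  rfl

/-- **The morphism of [FrdII] model data over `prodEquiv : D⊢_v ⥲ D^Θ_v`** from the data of `C⊢_v` to those of
`C^Θ_v`: the pull-back maps of `Φ_{C⊢_v}`, `B_{C⊢_v}` along the (inverse) unit `prodEquiv⁻¹(prodEquiv A) → A`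
(the data of `C^Θ_v` at `A^Θ` ARE those of `C⊢_v` at `prodEquiv⁻¹(A^Θ)`). [cite: Mochizuki2012, I Ex 3.2 (v) p.72] -/
def dashThetaHom :
    ModelFrobenioid.DataHomOver T.prodEquiv.functor (d.dashDatum hq).divB (T.thetaDatum d hq).divB :=
  ModelFrobenioid.restrictAlong (G₁ := 𝟭 (CosetCat d.Gal)) (G₂ := T.prodEquiv.functor ⋙ T.prodEquiv.inverse)
    T.prodEquiv.unitInv (d.dashDatum hq).Φ (d.dashDatum hq).B (d.dashDatum hq).divB

/-- The `Φ`-component of `dashThetaHom` is bijective (pull-back along an isomorphism).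
[cite: Mochizuki2012, I Ex 3.2 (v) p.72] -/
theorem dashThetaHom_η_bijective (X : CosetCat d.Gal) :
    Function.Bijective ((T.dashThetaHom d hq).η.app (op X)).hom :=
  (Iso.commMonCatIsoToMulEquiv ((d.dashDatum hq).Φ.mapIso ((T.prodEquiv.unitIso.app X).symm.op))).bijective

/-- The `B`-component of `dashThetaHom` is bijective. [cite: Mochizuki2012, I Ex 3.2 (v) p.72] -/
theorem dashThetaHom_β_bijective (X : CosetCat d.Gal) :
    Function.Bijective ((T.dashThetaHom d hq).β.app (op X)).hom :=
  (Iso.commMonCatIsoToMulEquiv ((d.dashDatum hq).B.mapIso ((T.prodEquiv.unitIso.app X).symm.op))).bijective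

/-- **The induced functor `C⊢_v → C^Θ_v` is an equivalence** ([FrdI] Cor. 5.4 via abc-iut-w5-d137's criterion: over
an equivalence of bases, along bijective components). [cite: Mochizuki2012, I Ex 3.2 (v) p.72] -/
theorem dashThetaFunctor_isEquivalence : (T.dashThetaHom d hq).functor.IsEquivalence :=
  ModelFrobenioid.DataHomOver.functor_isEquivalence _ (T.dashThetaHom_η_bijective d hq)
    (T.dashThetaHom_β_bijective d hq)

/-- **"we have a natural equivalence of categories `C⊢_v ⥲ C^Θ_v`"** — CONSTRUCTED for the coset models.
[cite: Mochizuki2012, I Ex 3.2 (v) p.72] -/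
def dashThetaEquiv : d.Cdash hq ≌ T.CTheta d hq :=
  haveI := T.dashThetaFunctor_isEquivalence d hq
  (T.dashThetaHom d hq).functor.asEquivalence

/-- Its functor IS the functor induced by `dashThetaHom`. [cite: Mochizuki2012, I Ex 3.2 (v) p.72] -/
theorem dashThetaEquiv_functor : (T.dashThetaEquiv d hq).functor = (T.dashThetaHom d hq).functor := rfl

/-- `C⊢_v ⥲ C^Θ_v` lies over `D⊢_v ⥲ D^Θ_v` ON THE NOSE. [cite: Mochizuki2012, I Ex 3.2 (v) p.72] -/
theorem dashThetaEquiv_comp_base :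
    (T.dashThetaEquiv d hq).functor ⋙ T.CThetaBase d hq = d.CdashBase hq ⋙ T.prodEquiv.functor :=
  ModelFrobenioid.DataHomOver.functor_comp_baseFunctor _

/-- The same as a natural isomorphism (shape of the interface field `dashThetaEquiv_base`).
[cite: Mochizuki2012, I Ex 3.2 (v) p.72] -/
def dashThetaEquivBaseIso :
    d.CdashBase hq ⋙ T.prodEquiv.functor ≅ (T.dashThetaEquiv d hq).functor ⋙ T.CThetaBase d hq :=
  eqToIso (T.dashThetaEquiv_comp_base d hq).symm

/-- **"that maps `τ⊢_v` to `τ^Θ_v`"**, member by member: for every associate `q″` of `q̲_v` the equivalence carries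
the splitting `τ(q″)` on `C⊢_v` onto the splitting `τ(q″)` on `C^Θ_v` (image AND preimage: the rational function of
`Ψ(φ)` restricted to the base field is the Galois-translate of that of `φ`, and `q″` is a constant section).
[cite: Mochizuki2012, I Ex 3.2 (v) p.73] -/
theorem dashThetaEquiv_tau (q'' : intNonzero d.k) (hq'' : Associated q'' q) :
    (d.tauDashOf hq q'').IsPreservedBy (T.tauThetaOf d hq q'') (T.dashThetaEquiv d hq).functor := by
  intro A
  haveI := T.dashThetaFunctor_isEquivalence d hq
  have hcs : Monogenic.IsConstantSection d.fieldFunctor (d.relEmb.img q'') :=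
    d.relEmb.isConstantSection fun hu => hq (hq''.isUnit hu)
  rw [d.tauDashOf_sect hq q'' hq'', T.tauThetaOf_sect d hq q'' hq'']
  ext e'
  constructor
  · rintro ⟨e, ⟨he, m, hm⟩, rfl⟩
    refine ⟨⟨?_, he.2⟩, m, ?_⟩
    · change T.prodEquiv.functor.map (ModelFrobenioid.baseMap (End.asHom e)) = 𝟙 _
      have hb : ModelFrobenioid.baseMap (End.asHom e) = 𝟙 A.base := he.1
      rw [hb, CategoryTheory.Functor.map_id]
    · change (d.dashDatum hq).resK (T.prodEquiv.inverse.obj (T.prodEquiv.functor.obj A.base))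
          (((d.dashDatum hq).B.map (T.prodEquiv.unitInv.app A.base).op).hom (ModelFrobenioid.unit (End.asHom e))) =
        intNonzeroToUnits _ (d.relEmb.img q'' (T.prodEquiv.inverse.obj (T.prodEquiv.functor.obj A.base))) ^ m
      let σ : (d.dashDatum hq).fld ((𝟭 T.Ddash).obj A.base) →*
          (d.dashDatum hq).fld ((T.prodEquiv.functor ⋙ T.prodEquiv.inverse).obj A.base) :=
        ((d.dashDatum hq).base.map (T.prodEquiv.unitInv.app A.base)).alg
      have key : _ = Units.map σ _ :=
        (d.dashDatum hq).resK_mapB (T.prodEquiv.unitInv.app A.base) (ModelFrobenioid.unit (End.asHom e))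
      beta_reduce at hm
      exact key.trans ((congrArg (Units.map σ) hm).trans ((map_pow (Units.map σ) _ m).trans
        (congrArg (· ^ m) (hcs.units_map_eq d.fieldFunctor (T.prodEquiv.unitInv.app A.base)))))
  · rintro ⟨he', m, hm⟩
    obtain ⟨e, rfl⟩ := (T.dashThetaHom d hq).functor.map_surjective (e' : _ ⟶ _)
    refine ⟨e, ⟨⟨?_, he'.2⟩, m, ?_⟩, rfl⟩
    · have hb : T.prodEquiv.functor.map (ModelFrobenioid.baseMap e) = 𝟙 _ := he'.1
      change ModelFrobenioid.baseMap e = 𝟙 A.base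
      apply T.prodEquiv.functor.map_injective
      rw [hb, CategoryTheory.Functor.map_id]
    · have hm' : (d.dashDatum hq).resK (T.prodEquiv.inverse.obj (T.prodEquiv.functor.obj A.base))
          (((d.dashDatum hq).B.map (T.prodEquiv.unitInv.app A.base).op).hom (ModelFrobenioid.unit e)) =
        intNonzeroToUnits _ (d.relEmb.img q'' (T.prodEquiv.inverse.obj (T.prodEquiv.functor.obj A.base))) ^ m := hm
      let σ : (d.dashDatum hq).fld ((𝟭 T.Ddash).obj A.base) →*
          (d.dashDatum hq).fld ((T.prodEquiv.functor ⋙ T.prodEquiv.inverse).obj A.base) :=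
        ((d.dashDatum hq).base.map (T.prodEquiv.unitInv.app A.base)).alg
      have key : _ = Units.map σ _ :=
        (d.dashDatum hq).resK_mapB (T.prodEquiv.unitInv.app A.base) (ModelFrobenioid.unit e)
      have h2 : Units.map σ ((d.dashDatum hq).resK A.base (ModelFrobenioid.unit e)) =
          Units.map σ ((intNonzeroToUnits (d.fieldFunctor.obj A.base).K) (d.relEmb.img q'' A.base) ^ m) :=
        key.symm.trans (hm'.trans
          (((congrArg (· ^ m) (hcs.units_map_eq d.fieldFunctor (T.prodEquiv.unitInv.app A.base)).symm)).trans
            (map_pow (Units.map σ) _ m).symm))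
      exact Units.map_injective
        (RingHom.injective ((d.dashDatum hq).base.map (T.prodEquiv.unitInv.app A.base)).alg) h2

end BadLocalGroupDatum

end Literature.IUT.HodgeTheaters

end
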